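import Summits.QuantumAdvantage.QuantumAdvantage.Theorems.PureCubicClassNumberHard.Negative.InfinitelyOften
import HarnessLib

set_option linter.dupNamespace false -- D-0017: single-problem summit ⇒ `QuantumAdvantage.QuantumAdvantage` by design

/-!
# Worst-case Φ-hiding(3) is infinitely-often hardness (Boolean-output PPT algorithms)

Helper file for crux `stmt-QuantumAdvantage-11826` (`PureCubicClassNumberHard`, route
`LinnikCubicClassGroups`), leaf `stub_phiHiding3` / `PhiHidingThree` (`Theorems/PhiHidingThree.lean`).
Port of the refuter's `Negative/InfinitelyOften.lean` (there: `RandAlg (List Bool) (List Bool)`,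
`IsPolyTime id id`, inputs = strings) to the shape of the leaf: BOOLEAN outputs
(`RandAlg (List Bool) Bool`, `IsPolyTime id encodeBool`) and inputs = NATURALS presented by
`encodeNat`.

* `isPolyTime_patchBool` — PPT Boolean-output algorithms are closed under patching ONE input string
  with a fixed answer (transport of the tree's `isPolyTime_patch` through `encodeBool`);
  `pr_patchBool_self`, `pr_patchBool_of_ne` — the output law of the patched algorithm.
* `hardBool_iff_infinitely_often` — for any target bit `t : ℕ → Bool` and validity predicate
  `P : ℕ → Prop`: "no PPT `D` outputs `t N` w.p. `≥ 2/3` on every valid `N`" `↔` "every PPT `D`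
  fails (`Pr < 2/3`) on INFINITELY many valid `N`" (finite patching, `encodeNat` injective).
* `phiHidingThreeBody_iff_infinitelyOften` — the body of `PhiHidingThree` in that form: the
  conjecture cannot be weakened to (is not stronger than) its "infinitely often" reading; a
  refutation must be ONE PPT algorithm correct on ALL BUT FINITELY MANY members of the family, and a
  proof must defeat each PPT algorithm on an infinite subfamily.

The patched algorithm is written as a structure literal
`{ run := fun x r => if x = x₀ then v else D.run x r, coinLen := D.coinLen }` (no new definition).
-/

namespace Summit.QuantumAdvantage.QuantumAdvantage.Theorems

open Literature.Computability.Complexity _root_.Computability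
open PureCubicClassNumberHard.Negative (patch isPolyTime_patch)

/-! ### Patching one input of a Boolean-output PPT algorithm -/

/-- The `encodeBool`-wrapping of a Boolean-output randomized algorithm (outputs `[b]`) is PPT in
the string sense `IsPolyTime id id` when the original is PPT in the sense `IsPolyTime id encodeBool`
(same machine). [folklore] -/
theorem isPolyTime_encodeBool_wrap {D : RandAlg (List Bool) Bool} (hD : D.IsPolyTime id encodeBool) :
    ({ run := fun x r => encodeBool (D.run x r), coinLen := D.coinLen } :
      RandAlg (List Bool) (List Bool)).IsPolyTime id id :=
  ⟨PolyTimeComputable.of_encode_eq (f := Function.uncurry D.run)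
      (ea := fun p : List Bool × List Bool => boolPair p.1 p.2) (eb := encodeBool)
      (id : List Bool × List Bool → List Bool × List Bool) (fun _ => rfl) (fun _ => rfl) hD.1,
    hD.2⟩

/-- **Boolean-output PPT algorithms are closed under patching one input**: replacing the answer at
the single input `x₀` by the constant `v` (same coins, ignored there) keeps `IsPolyTime id encodeBool`
— via the tree's string-level `isPolyTime_patch` applied to the `encodeBool`-wrapping, transported
back through `encodeBool`. [folklore] -/
theorem isPolyTime_patchBool {D : RandAlg (List Bool) Bool} (hD : D.IsPolyTime id encodeBool)
    (x₀ : List Bool) (v : Bool) :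
    ({ run := fun x r => if x = x₀ then v else D.run x r, coinLen := D.coinLen } :
      RandAlg (List Bool) Bool).IsPolyTime id encodeBool := by
  refine ⟨?_, hD.2⟩
  have h := (isPolyTime_patch (isPolyTime_encodeBool_wrap hD) x₀ (encodeBool v)).1
  refine PolyTimeComputable.of_encode_eq
    (f := Function.uncurry
      (patch ({ run := fun x r => encodeBool (D.run x r), coinLen := D.coinLen } :
        RandAlg (List Bool) (List Bool)) x₀ (encodeBool v)).run)
    (ea := fun p : List Bool × List Bool => boolPair p.1 p.2) (eb := (id : List Bool → List Bool))
    (id : List Bool × List Bool → List Bool × List Bool) (fun _ => rfl) (fun p => ?_) h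
  obtain ⟨x, r⟩ := p
  simp only [id, Function.uncurry_apply_pair, patch]
  split_ifs <;> rfl

/-- At the patched input the patched algorithm answers `v` with probability `1`. [folklore] -/
theorem pr_patchBool_self (D : RandAlg (List Bool) Bool) (x₀ : List Bool) (v : Bool) :
    ({ run := fun x r => if x = x₀ then v else D.run x r, coinLen := D.coinLen } :
      RandAlg (List Bool) Bool).pr id x₀ {b | b = v} = 1 := by
  have h : ({ run := fun x r => if x = x₀ then v else D.run x r, coinLen := D.coinLen } :
      RandAlg (List Bool) Bool).outputPMF id x₀ = PMF.pure v := by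
    simp only [RandAlg.outputPMF, if_true]
    exact PMF.map_const _ _
  rw [RandAlg.pr, h, PMF.toOuterMeasure_pure_apply]
  simp

/-- Away from the patched input the output law is unchanged. [folklore] -/
theorem pr_patchBool_of_ne (D : RandAlg (List Bool) Bool) (x₀ : List Bool) (v : Bool)
    {x : List Bool} (hx : x ≠ x₀) (E : Set Bool) :
    ({ run := fun x r => if x = x₀ then v else D.run x r, coinLen := D.coinLen } :
      RandAlg (List Bool) Bool).pr id x E = D.pr id x E := by
  simp only [RandAlg.pr, RandAlg.outputPMF, if_neg hx]

/-! ### Worst-case hardness = infinitely-often hardness -/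

/-- **Worst-case hardness of a bit of a natural number is automatically infinitely-often hardness.**
For any target bit `t : ℕ → Bool` and validity predicate `P : ℕ → Prop`: "no PPT Boolean-output
algorithm outputs `t N` with probability `≥ 2/3` on (the binary code of) every valid `N`" is
EQUIVALENT to "every such algorithm fails on INFINITELY many valid `N`" — an algorithm failing on
finitely many inputs is patched input by input (`isPolyTime_patchBool`; `encodeNat` is injective).
[folklore] -/
theorem hardBool_iff_infinitely_often (t : ℕ → Bool) (P : ℕ → Prop) :
    (¬ ∃ D : RandAlg (List Bool) Bool, D.IsPolyTime id encodeBool ∧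
        ∀ N, P N → (2 : ℝ) / 3 ≤ D.pr id (encodeNat N) {b | b = t N}) ↔
      ∀ D : RandAlg (List Bool) Bool, D.IsPolyTime id encodeBool →
        {N | P N ∧ D.pr id (encodeNat N) {b | b = t N} < 2 / 3}.Infinite := by
  constructor
  · intro hX D hD
    by_contra hfin
    rw [Set.not_infinite] at hfin
    have key : ∀ (S : Finset ℕ) (B : RandAlg (List Bool) Bool),
        B.IsPolyTime id encodeBool → {N | P N ∧ B.pr id (encodeNat N) {b | b = t N} < 2 / 3} ⊆ ↑S →
          ∃ C : RandAlg (List Bool) Bool, C.IsPolyTime id encodeBool ∧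
            ∀ N, P N → (2 : ℝ) / 3 ≤ C.pr id (encodeNat N) {b | b = t N} := by
      intro S
      induction S using Finset.induction_on with
      | empty =>
        intro B hB hsub
        exact ⟨B, hB, fun N hN => not_lt.mp fun hlt => by simpa using hsub ⟨hN, hlt⟩⟩
      | insert N₀ S _ ih =>
        intro B hB hsub
        refine ih
          ({ run := fun x r => if x = encodeNat N₀ then t N₀ else B.run x r
             coinLen := B.coinLen } : RandAlg (List Bool) Bool) (isPolyTime_patchBool hB _ _) ?_
        rintro N ⟨hPN, hlt⟩
        have hne : N ≠ N₀ := by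
          rintro rfl
          rw [pr_patchBool_self] at hlt
          norm_num at hlt
        have hne' : encodeNat N ≠ encodeNat N₀ := fun h =>
          hne (by simpa using congrArg decodeNat h)
        rw [pr_patchBool_of_ne _ _ _ hne'] at hlt
        have hN := hsub ⟨hPN, hlt⟩
        rw [Finset.coe_insert] at hN
        rcases hN with rfl | hN
        · exact absurd rfl hne
        · exact hN
    obtain ⟨C, hC, hcorr⟩ := key hfin.toFinset D hD (fun N hN => by simpa using hN)
    exact hX ⟨C, hC, hcorr⟩
  · rintro h ⟨D, hD, hcorr⟩
    refine h D hD ?_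
    have hempty : {N | P N ∧ D.pr id (encodeNat N) {b | b = t N} < 2 / 3} = ∅ := by
      ext N
      simp only [Set.mem_setOf_eq, Set.mem_empty_iff_false, iff_false, not_and, not_lt]
      exact hcorr N
    rw [hempty]
    exact Set.finite_empty

/-- **The body of `PhiHidingThree`, infinitely-often form.** Worst-case Φ-hiding(3) on the family
`N = pq ≡ 1 (mod 9)` minus `(8,8)` (the `∃`-free left side is `PhiHidingThree` unfolded) holds iff
EVERY PPT Boolean-output algorithm outputs the bit `[3 ∣ φ(N)]` with probability `< 2/3` on
INFINITELY many members `N` of the family.  So the conjecture is not stronger than its i.o. reading: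
refuting it means ONE PPT algorithm correct on all but finitely many members. [folklore] -/
theorem phiHidingThreeBody_iff_infinitelyOften :
    (¬ ∃ D : RandAlg (List Bool) Bool, D.IsPolyTime id encodeBool ∧
      ∀ p q : ℕ, p.Prime → q.Prime → p ≠ q → (p * q) % 9 = 1 → ¬ (p % 9 = 8 ∧ q % 9 = 8) →
        (2 : ℝ) / 3 ≤ D.pr id (encodeNat (p * q)) {b | b = decide (3 ∣ Nat.totient (p * q))}) ↔
    ∀ D : RandAlg (List Bool) Bool, D.IsPolyTime id encodeBool →
      {N : ℕ | (∃ p q : ℕ, p.Prime ∧ q.Prime ∧ p ≠ q ∧ (p * q) % 9 = 1 ∧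
          ¬ (p % 9 = 8 ∧ q % 9 = 8) ∧ N = p * q) ∧
        D.pr id (encodeNat N) {b | b = decide (3 ∣ Nat.totient N)} < 2 / 3}.Infinite := by
  rw [← hardBool_iff_infinitely_often (fun N => decide (3 ∣ Nat.totient N))
    (fun N => ∃ p q : ℕ, p.Prime ∧ q.Prime ∧ p ≠ q ∧ (p * q) % 9 = 1 ∧
      ¬ (p % 9 = 8 ∧ q % 9 = 8) ∧ N = p * q)]
  refine not_congr (exists_congr fun D => and_congr_right fun _ => ⟨fun h N hN => ?_, fun h => ?_⟩)
  · obtain ⟨p, q, hp, hq, hpq, h9, h88, rfl⟩ := hN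
    exact h p q hp hq hpq h9 h88
  · intro p q hp hq hpq h9 h88
    exact h (p * q) ⟨p, q, hp, hq, hpq, h9, h88, rfl⟩

end Summit.QuantumAdvantage.QuantumAdvantage.Theorems
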